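import Literature.NumberTheory.LFunctions.Zhang2022.DHMenuConsistentP4B
import HarnessLib

/-!
# B-DH-W row dhE-04, the WORLD HALF above `Re = ½`: the count facts `hone`, `hhalf`, `hhalfX`, `hbeta` of
# `Zhang2022.DH.row04_of_counts` (ls-barrier-p1, `DHMenuConsistentRow04.lean`) for the (A)-world `W(D, χ)`
# (cell `landau-siegel`, §E theorem `menuConsistent_holds`; ls-Bdh-typer-1, offer 2026-08-26T20:4xZ)

Topic `Literature/NumberTheory/LFunctions/Zhang2022` (namespace `Literature.NumberTheory.LFunctions.Zhang2022.DH`). For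
`w := world D χ` with `log D ≥ 43 250` and `χ` primitive, in exactly the binder shapes of `row04_of_counts`:

* `world_zeroCount_eq_zero_of_one_le` (`hone`): `N_W(σ, Q) = 0` for `σ ≥ 1` — no zero of the world has `Re ρ > 1`
  (`re_gt_half_zero`: a zero with `Re ρ > ½` is `β₁(D) < 1`);
* `world_zeroCount_le_one_of_half_le` (`hhalf`): `N_W(σ, Q) ≤ 1` for `σ ≥ ½` — in the double sum over levels
  `i + 1 ≤ ⌊Q⌋` and primitive characters, a non-zero term forces an induced PRIMITIVE slot, i.e. the slot `(D, χ)`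
  (`IsExcSlot.level_eq`, `IsExcSlot.eq_of_eq`), and that term is `≤ 1` (its zero box is `⊆ {β₁(D)}`);
* `world_zeroCountExcl_eq_zero_of_half_le` (`hhalfX`): `N*_W(σ, Q) = 0` for `σ ≥ ½` — the one candidate `β₁(D)` on a
  slot of level `≤ Q` forces `D ≤ Q`, whence `β₁(Q) = β₁(D)` (`betaOne_world_eq`) is exactly the excluded point;
* `world_betaOne_dichotomy` (`hbeta`): `β₁(Q) = 0` when `Q < D` (the family's real zero set is EMPTY: fence points are
  off the real axis by ls-barrier-p4's `im_ne_zero_of_mem_fence`, induced slots have level `≥ D`), and otherwise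
  `43250 ≤ log Q`, `2/(3 (log Q)^2022) ≤ 1 − β₁(Q) = δ(log D) = 2/(3 (log D)^2022)`, `β₁(Q) ≤ 1`.

So `row04` for the world is `row04_of_counts (world D χ) hone hhalf hhalfX hlow hlowX hbeta` with only the two
low-`σ` fence-count bounds `hlow`/`hlowX` (`≤ Q⁴`, from `DHMenuConsistentFence`) left to the row04 owner. No
`L`-function, no named fact. «The programme SEARCHES and TYPES; no claim about Landau–Siegel zeros, Theorems 1–2 of
arXiv:2211.02515 or a repaired Margin232 until a kernel theorem says so.»

## References

* `B-dh/SIGMA-E-HANDOVER.md` v1.1 (row04, d1–d2); ls-barrier-plan 20:05:01Z (b).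
* [ThornerZaman2024LogFree] Thm. 1.2 / Cor. 6.1 (the row's source); [Zhang2022LandauSiegel] §2 Assumption (A).
-/

noncomputable section

open scoped Classical
open Complex

namespace Literature.NumberTheory.LFunctions.Zhang2022.DH

section Row04High

variable {D : ℕ} {χ : DirichletCharacter ℂ D} (hL : (43250 : ℝ) ≤ Real.log D)
include hL

/-- For `σ ≥ ½` the zero box of any slot is `⊆ {β₁(D)}`. [cite: ThornerZaman2024LogFree, §1 (1.2)] -/
theorem world_zeroSetRe_subset_singleton {q : ℕ} (ψ : DirichletCharacter ℂ q) {σ : ℝ} (hσ : 1 / 2 ≤ σ) (H : ℝ) :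
    (world D χ).zeroSetRe q ψ σ H ⊆ {((betaExc D : ℝ) : ℂ)} := by
  rintro ρ ⟨hz, hre, -⟩
  exact (re_gt_half_zero hL hz (lt_of_le_of_lt hσ hre)).2

/-- For `σ ≥ ½` a NON-EMPTY zero box forces an induced slot. [cite: ThornerZaman2024LogFree, §1 (1.2)] -/
theorem isExcSlot_of_mem_zeroSetRe {q : ℕ} {ψ : DirichletCharacter ℂ q} {σ : ℝ} (hσ : 1 / 2 ≤ σ) {H : ℝ} {ρ : ℂ}
    (h : ρ ∈ (world D χ).zeroSetRe q ψ σ H) : IsExcSlot D χ q ψ := by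
  obtain ⟨hz, hre, -⟩ := h
  exact (re_gt_half_zero hL hz (lt_of_le_of_lt hσ hre)).1

/-- For `σ ≥ 1` every zero box of the world is EMPTY (`β₁(D) < 1`). [cite: ThornerZaman2024LogFree, §1 (1.2)] -/
theorem world_zeroSetRe_eq_empty_of_one_le {q : ℕ} (ψ : DirichletCharacter ℂ q) {σ : ℝ} (hσ : 1 ≤ σ) (H : ℝ) :
    (world D χ).zeroSetRe q ψ σ H = ∅ := by
  ext ρ
  simp only [Set.mem_empty_iff_false, iff_false]
  rintro ⟨hz, hre, -⟩
  obtain ⟨-, rfl⟩ := re_gt_half_zero hL hz (by linarith)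
  rw [Complex.ofReal_re] at hre
  linarith [(betaExc_window hL).2]

/-- For `σ ≥ ½` each box count of the world is `≤ 1`. [cite: ThornerZaman2024LogFree, §1 (1.2)] -/
theorem world_charZeroCountRe_le_one {q : ℕ} [NeZero q] (ψ : DirichletCharacter ℂ q) {σ : ℝ} (hσ : 1 / 2 ≤ σ)
    (H : ℝ) : (world D χ).charZeroCountRe q ψ σ H ≤ 1 := by
  unfold ZeroWorld.charZeroCountRe
  rcases Set.subset_singleton_iff_eq.mp (world_zeroSetRe_subset_singleton hL ψ hσ H) with h | h
  · rw [h, finsum_mem_empty]; exact zero_le_one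
  · rw [h, finsum_mem_singleton]; exact mult_world_le_one χ ψ _

/-- **`hone` for the world**: `N_W(σ, Q) = 0` for `σ ≥ 1`. [cite: ThornerZaman2024LogFree, Theorem 1.2] -/
theorem world_zeroCount_eq_zero_of_one_le : ∀ Q σ : ℝ, 3 ≤ Q → 1 ≤ σ → (world D χ).zeroCount σ Q = 0 := by
  intro Q σ _ hσ
  unfold ZeroWorld.zeroCount
  refine Finset.sum_eq_zero (fun i _ => Finset.sum_eq_zero (fun ψ _ => ?_))
  split_ifs
  · unfold ZeroWorld.charZeroCountRe
    rw [world_zeroSetRe_eq_empty_of_one_le hL ψ hσ Q, finsum_mem_empty]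
  · rfl

omit hL in
/-- A sum of terms each `≤ 1`, at most one of which is non-zero, is `≤ 1`. [folklore] -/
private theorem sum_le_one_of_atMostOne {ι : Type*} (s : Finset ι) (f : ι → ℕ) (hle : ∀ i ∈ s, f i ≤ 1)
    (huniq : ∀ i ∈ s, ∀ j ∈ s, f i ≠ 0 → f j ≠ 0 → i = j) : ∑ i ∈ s, f i ≤ 1 := by
  by_cases h : ∃ i ∈ s, f i ≠ 0
  · obtain ⟨i₀, hi₀, hf⟩ := h
    rw [Finset.sum_eq_single_of_mem i₀ hi₀ (fun j hj hne => ?_)]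
    · exact hle i₀ hi₀
    · by_contra hj0
      exact hne (huniq j hj i₀ hi₀ hj0 hf)
  · push Not at h
    rw [Finset.sum_eq_zero h]
    exact zero_le_one

/-- **`hhalf` for the world**: `N_W(σ, Q) ≤ 1` for `σ ≥ ½` — only the slot `(D, χ)` can contribute, and at most `1`.
[cite: ThornerZaman2024LogFree, Theorem 1.2] -/
theorem world_zeroCount_le_one_of_half_le (hprim : χ.IsPrimitive) :
    ∀ Q σ : ℝ, 3 ≤ Q → 1 / 2 ≤ σ → ((world D χ).zeroCount σ Q : ℝ) ≤ 1 := by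
  intro Q σ _ hσ
  have key : (world D χ).zeroCount σ Q ≤ 1 := by
    unfold ZeroWorld.zeroCount
    -- a term is non-zero only on an induced primitive slot, i.e. on `(D, χ)`
    have hterm : ∀ (i : ℕ) (ψ : DirichletCharacter ℂ (i + 1)),
        (if ψ.IsPrimitive then (world D χ).charZeroCountRe (i + 1) ψ σ Q else 0) ≠ 0 →
          ψ.IsPrimitive ∧ IsExcSlot D χ (i + 1) ψ := by
      intro i ψ h
      by_cases hp : ψ.IsPrimitive
      · refine ⟨hp, ?_⟩
        rw [if_pos hp] at h
        unfold ZeroWorld.charZeroCountRe at h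
        by_contra hs
        apply h
        have hempty : (world D χ).zeroSetRe (i + 1) ψ σ Q = ∅ := by
          ext ρ
          simp only [Set.mem_empty_iff_false, iff_false]
          intro hρ
          exact hs (isExcSlot_of_mem_zeroSetRe hL hσ hρ)
        rw [hempty, finsum_mem_empty]
      · rw [if_neg hp] at h; exact absurd rfl h
    refine sum_le_one_of_atMostOne _ _ (fun i _ => ?_) (fun i _ j _ hi hj => ?_)
    · -- inner sum ≤ 1
      refine sum_le_one_of_atMostOne _ _ (fun ψ _ => ?_) (fun ψ _ ψ' _ hψ hψ' => ?_)
      · split_ifs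
        · exact world_charZeroCountRe_le_one hL ψ hσ Q
        · exact zero_le_one
      · exact (hterm i ψ hψ).2.eq_of_eq (hterm i ψ' hψ').2
    · -- two levels with a non-zero inner sum are both `D`
      obtain ⟨ψ, -, hψ⟩ := Finset.exists_ne_zero_of_sum_ne_zero hi
      obtain ⟨ψ', -, hψ'⟩ := Finset.exists_ne_zero_of_sum_ne_zero hj
      have h1 := (hterm i ψ hψ).2.level_eq hprim (hterm i ψ hψ).1
      have h2 := (hterm j ψ' hψ').2.level_eq hprim (hterm j ψ' hψ').1
      omega
  exact_mod_cast key

/-- **`hhalfX` for the world**: `N*_W(σ, Q) = 0` for `σ ≥ ½` — the only candidate `β₁(D)`, on a slot of level `≤ Q`,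
is the excluded point `β₁(Q)` (`betaOne_world_eq`). [cite: ThornerZaman2024LogFree, Theorem 1.2] -/
theorem world_zeroCountExcl_eq_zero_of_half_le (hprim : χ.IsPrimitive) :
    ∀ Q σ : ℝ, 3 ≤ Q → 1 / 2 ≤ σ → (world D χ).zeroCountExcl σ Q = 0 := by
  intro Q σ hQ hσ
  unfold ZeroWorld.zeroCountExcl
  refine Finset.sum_eq_zero (fun i hi => Finset.sum_eq_zero (fun ψ _ => ?_))
  split_ifs
  · have hempty : (world D χ).zeroSetRe (i + 1) ψ σ Q \ {(((world D χ).betaOne Q : ℝ) : ℂ)} = ∅ := by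
      ext ρ
      simp only [Set.mem_sdiff, Set.mem_singleton_iff, Set.mem_empty_iff_false, iff_false, not_and, not_not]
      intro hρ
      have hs := isExcSlot_of_mem_zeroSetRe hL hσ hρ
      have hρ' := world_zeroSetRe_subset_singleton hL ψ hσ Q hρ
      rw [Set.mem_singleton_iff] at hρ'
      haveI : NeZero (i + 1) := ⟨Nat.succ_ne_zero i⟩
      have hDi : (D : ℝ) ≤ ((i + 1 : ℕ) : ℝ) := hs.cast_le
      have hiQ : ((i + 1 : ℕ) : ℝ) ≤ Q := by
        have : i + 1 ≤ ⌊Q⌋₊ := Finset.mem_range.mp hi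
        exact le_trans (by exact_mod_cast this) (Nat.floor_le (by linarith))
      rw [hρ', betaOne_world_eq hL hprim (le_trans hDi hiQ)]
    rw [hempty, finsum_mem_empty]
  · rfl

/-- **`hbeta` for the world**: for `Q ≥ 3`, either `β₁(Q) = 0` (when `Q < D`: the family has NO real zero — fence
points are off the real axis, induced slots have level `≥ D`), or `43250 ≤ log Q`,
`2/(3 (log Q)^2022) ≤ 1 − β₁(Q)` and `β₁(Q) ≤ 1` (when `D ≤ Q`: `β₁(Q) = β₁(D)`, `1 − β₁(D) = 2/(3 (log D)^2022)`).
[cite: ThornerZaman2024LogFree, §1 (1.1)] -/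
theorem world_betaOne_dichotomy (hprim : χ.IsPrimitive) : ∀ Q : ℝ, 3 ≤ Q → (world D χ).betaOne Q = 0 ∨
    (43250 ≤ Real.log Q ∧ 2 / (3 * Real.log Q ^ 2022) ≤ 1 - (world D χ).betaOne Q ∧ (world D χ).betaOne Q ≤ 1) := by
  intro Q hQ
  by_cases hDQ : (D : ℝ) ≤ Q
  · right
    have hD0 := cast_pos_of_hL hL
    have hlog : Real.log D ≤ Real.log Q := Real.log_le_log hD0 hDQ
    rw [betaOne_world_eq hL hprim hDQ]
    refine ⟨le_trans hL hlog, ?_, le_of_lt (betaExc_window hL).2⟩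
    rw [one_sub_betaExc, DHMenuLines.delta]
    have hl0 : 0 < Real.log (D : ℝ) := log_pos_of_hL hL
    have hp : Real.log (D : ℝ) ^ 2022 ≤ Real.log Q ^ 2022 := pow_le_pow_left₀ hl0.le hlog _
    have hp0 : 0 < Real.log (D : ℝ) ^ 2022 := pow_pos hl0 _
    exact div_le_div_of_nonneg_left (by norm_num) (by positivity) (by linarith)
  · left
    push Not at hDQ
    have hempty : (world D χ).realZeroSet Q = ∅ := by
      ext β
      simp only [Set.mem_empty_iff_false, iff_false]
      rintro ⟨i, hi, ψ, -, hz⟩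
      haveI : NeZero (i + 1) := ⟨Nat.succ_ne_zero i⟩
      rw [isZero_world_iff] at hz
      rcases hz with hf | ⟨hs, -⟩
      · have hc : 1 ≤ ψ.conductor := Nat.one_le_iff_ne_zero.mpr (DirichletCharacter.conductor_ne_zero ψ)
        have := im_ne_zero_of_mem_fence hc hf
        rw [Complex.ofReal_im] at this
        exact this rfl
      · have hDi : (D : ℝ) ≤ ((i + 1 : ℕ) : ℝ) := hs.cast_le
        have hiQ : ((i + 1 : ℕ) : ℝ) ≤ Q :=
          le_trans (by exact_mod_cast (show i + 1 ≤ ⌊Q⌋₊ by omega)) (Nat.floor_le (by linarith))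
        linarith
    unfold ZeroWorld.betaOne
    rw [hempty, Real.sSup_empty]

end Row04High

end Literature.NumberTheory.LFunctions.Zhang2022.DH

end
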